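import Literature.NumberTheory.Transcendental.KZDilationLogGenerators
import HarnessLib

/-!
# The logarithmic sector of the Kontsevich–Zagier dilation pencil, IV: generators on arbitrary
positive Nash bases

Setting of `KZDilationLogSector.lean` (`(a, b) ⊇ [0,1]`). `KZDilationLogGenerators.lean` treated the
generators `Π_k (1 − x/α_k)^{N_k}` of the logarithmic sector with real poles. Here the bases are
ARBITRARY positive functions `u_k` on `(a,b)` given with their derivatives `u_k'` (and, for the
Nash statements, `ℚ`-semialgebraic and real-analytic):
  `Q_N(x) = Π_k u_k(x)^{N_k}`  (`N_k ∈ ℚ`),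
with `Q_N = exp(Σ_k N_k log u_k)`, `Q_N > 0`, `Q_N' = (Σ_k N_k u_k'/u_k)·Q_N`, analyticity and
`ℚ`-semialgebraicity, and `Q_N(x) = 1` wherever `Σ_k N_k log u_k(x) = 0` (`nashProd_*`). Used with
the positive quadratics `u_k(x) = (1 − p_k x)² + (q_k x)²` (squared moduli of `1 − x/α_k` for COMPLEX
poles `α_k`) in the complex Baker sector of the dilation lifting problem (route
`KontsevichZagierPeriods/LiftingCriteria`, crux `DilationLiftAtOne`).

Everything is proved; no `def`, no named fact.

## References
* M. Kontsevich, D. Zagier, *Periods* (2001), §1.2. [`KontsevichZagier2001`]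
* J. Bochnak, M. Coste, M.-F. Roy, *Real Algebraic Geometry* (1998), Prop. 2.2.6. [`BochnakCosteRoy1998`]
-/

noncomputable section

open Set MeasureTheory Filter MvPolynomial
open scoped BigOperators Topology
open Literature.ModelTheory.ExponentialFields

namespace Literature.NumberTheory.Transcendental

namespace KZ.DilationLogSector

section NashGenerators

variable {a b : ℝ} {A : ℕ} {u u' : Fin A → ℝ → ℝ}

/-- On `(a,b)`: `Π_k u_k^{N_k} = exp(Σ_k N_k log u_k)` for positive bases. [folklore] -/
theorem nashProd_eq_exp (hpos : ∀ k, ∀ x ∈ Ioo a b, 0 < u k x) (N : Fin A → ℚ) {x : ℝ}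
    (hx : x ∈ Ioo a b) :
    (∏ k, u k x ^ ((N k : ℚ) : ℝ)) = Real.exp (∑ k, (N k : ℝ) * Real.log (u k x)) := by
  rw [Real.exp_sum]
  refine Finset.prod_congr rfl fun k _ => ?_
  rw [Real.rpow_def_of_pos (hpos k x hx), mul_comm]

/-- `Π_k u_k^{N_k} > 0` on `(a,b)`. [folklore] -/
theorem nashProd_pos (hpos : ∀ k, ∀ x ∈ Ioo a b, 0 < u k x) (N : Fin A → ℚ) {x : ℝ}
    (hx : x ∈ Ioo a b) : 0 < ∏ k, u k x ^ ((N k : ℚ) : ℝ) := by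
  rw [nashProd_eq_exp hpos N hx]; exact Real.exp_pos _

/-- `Π_k u_k^{N_k} = 1` at a point where the logarithmic relation `Σ_k N_k log u_k = 0` holds.
[folklore] -/
theorem nashProd_eq_one_of (hpos : ∀ k, ∀ x ∈ Ioo a b, 0 < u k x) (N : Fin A → ℚ) {x : ℝ}
    (hx : x ∈ Ioo a b) (hrel : ∑ k, (N k : ℝ) * Real.log (u k x) = 0) :
    (∏ k, u k x ^ ((N k : ℚ) : ℝ)) = 1 := by
  rw [nashProd_eq_exp hpos N hx, hrel, Real.exp_zero]

/-- `(Π_k u_k^{N_k})' = (Σ_k N_k u_k'/u_k) · Π_k u_k^{N_k}` on `(a,b)` (logarithmic derivative).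
[folklore] -/
theorem hasDerivAt_nashProd (hpos : ∀ k, ∀ x ∈ Ioo a b, 0 < u k x)
    (hder : ∀ k, ∀ x ∈ Ioo a b, HasDerivAt (u k) (u' k x) x) (N : Fin A → ℚ) {x : ℝ}
    (hx : x ∈ Ioo a b) :
    HasDerivAt (fun x => ∏ k, u k x ^ ((N k : ℚ) : ℝ))
      ((∑ k, (N k : ℝ) * (u' k x / u k x)) * ∏ k, u k x ^ ((N k : ℚ) : ℝ)) x := by
  have hE : ∀ y ∈ Ioo a b, (∏ k, u k y ^ ((N k : ℚ) : ℝ)) =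
      Real.exp (∑ k, (N k : ℝ) * Real.log (u k y)) := fun y hy => nashProd_eq_exp hpos N hy
  have hsum : HasDerivAt (fun y => ∑ k, (N k : ℝ) * Real.log (u k y))
      (∑ k, (N k : ℝ) * (u' k x / u k x)) x :=
    HasDerivAt.fun_sum fun k _ => ((hder k x hx).log (hpos k x hx).ne').const_mul _
  have hexp := hsum.exp
  have heq : (fun y => Real.exp (∑ k, (N k : ℝ) * Real.log (u k y))) =ᶠ[𝓝 x]
      (fun x => ∏ k, u k x ^ ((N k : ℚ) : ℝ)) := by
    filter_upwards [Ioo_mem_nhds hx.1 hx.2] with y hy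
    exact (hE y hy).symm
  refine (hexp.congr_of_eventuallyEq heq.symm).congr_deriv ?_
  rw [hE x hx, mul_comm]

/-- `Π_k u_k^{N_k}` is real-analytic on `(a,b)` when the bases are. [folklore] -/
theorem analyticAt_nashProd (hpos : ∀ k, ∀ x ∈ Ioo a b, 0 < u k x)
    (hua : ∀ k, ∀ x ∈ Ioo a b, AnalyticAt ℝ (u k) x) (N : Fin A → ℚ) {x : ℝ} (hx : x ∈ Ioo a b) :
    AnalyticAt ℝ (fun x => ∏ k, u k x ^ ((N k : ℚ) : ℝ)) x := by
  have heq : (fun y => Real.exp (∑ k, (N k : ℝ) * Real.log (u k y))) =ᶠ[𝓝 x]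
      (fun x => ∏ k, u k x ^ ((N k : ℚ) : ℝ)) := by
    filter_upwards [Ioo_mem_nhds hx.1 hx.2] with y hy
    exact (nashProd_eq_exp hpos N hy).symm
  refine AnalyticAt.congr ?_ heq
  refine AnalyticAt.comp (g := Real.exp) analyticAt_rexp ?_
  refine Finset.analyticAt_fun_sum _ fun k _ => ?_
  refine analyticAt_const.mul ?_
  exact AnalyticAt.comp (g := Real.log) (analyticAt_log (hpos k x hx)) (hua k x hx)

/-- `Π_k u_k^{N_k}` is `ℚ`-semialgebraic on `(a,b)` when the bases are (rational powers of positive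
semialgebraic functions, finite products). [cite: BochnakCosteRoy1998, Prop. 2.2.6] -/
theorem isSemialgebraicFunOn_nashProd (hpos : ∀ k, ∀ x ∈ Ioo a b, 0 < u k x)
    (hI : IsSemialgebraic ℚ {t : Fin 1 → ℝ | t 0 ∈ Ioo a b})
    (hus : ∀ k, IsSemialgebraicFunOn ℚ {t : Fin 1 → ℝ | t 0 ∈ Ioo a b} (fun t => u k (t 0)))
    (N : Fin A → ℚ) :
    IsSemialgebraicFunOn ℚ {t : Fin 1 → ℝ | t 0 ∈ Ioo a b}
      (fun t => ∏ k, u k (t 0) ^ ((N k : ℚ) : ℝ)) :=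
  IsSemialgebraicFunOn.finset_prod hI Finset.univ fun k _ =>
    (hus k).rpow_ratCast hI (fun _ ht => hpos k _ ht) (N k)

/-- Continuity of the logarithmic derivative `Σ_k N_k u_k'/u_k` on `(a,b)` for analytic bases with
`u_k' = deriv u_k`. [folklore] -/
theorem continuousOn_logDeriv_nashProd (hpos : ∀ k, ∀ x ∈ Ioo a b, 0 < u k x)
    (hua : ∀ k, ∀ x ∈ Ioo a b, AnalyticAt ℝ (u k) x) (N : Fin A → ℚ) :
    ContinuousOn (fun x => ∑ k, (N k : ℝ) * (deriv (u k) x / u k x)) (Ioo a b) := by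
  refine continuousOn_finsetSum _ fun k _ => continuousOn_const.mul ?_
  intro x hx
  exact ((hua k x hx).deriv.continuousAt.div (hua k x hx).continuousAt
    (hpos k x hx).ne').continuousWithinAt

end NashGenerators

end KZ.DilationLogSector

end Literature.NumberTheory.Transcendental
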